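/-
Copyright (c) 2026 the pub-hodgecm-mathlib formalisation cell (harness21).  Prover seat hodgecm-mathlib-K2Liu-p07 (g3), Track B «K2-LIT»,
#184♮ = hLiu418 = `stmt-HodgeConjecture-24832`; #42S payer road, organ S1 (local Siegel–Weil spanning), ROAD W file F7r (CM sequel)
(LEAD F0P6-plan (g14) RULING «M-158a» (4)∕ADDENDUM (3)∕«M-158c»; organ lead's DESIGN-W3-v2 §2; referee K2Liu-ref1 (g5) AUDIT-AW2 «SIGN (M4)»).
-/
import Summits.HodgeConjecture.HodgeConjecture.Theorems.K2LiuLocalSWRamifiedRelativeSign     -- ★ F7r: witness calculus, `Ad(d_a)` stabilities, rank relation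
import Literature.NumberTheory.GelbartRogawski1991.LocalDoubledUnitarySplittingDataCM        -- ★ `isEpsilonChar_localComponent_inv`, `imagUnitSq`
import Literature.NumberTheory.Automorphic.UnitaryGroupNonsplitPlace                        -- ★ `PlacesOver.subsingleton_of_smul_eq`
import Literature.NumberTheory.QuadraticForms.HilbertReciprocityFiniteness                  -- ★ `hilbertSymbol_mul_sq_right`
import HarnessLib

/-!
# Crux `HLiu418`, #42S organ S1, ROAD W, file F7r (sequel): THE RANK-ONE LETTER `Ad(d_a) w₁ = ℓ₁ w₁`, `det_Δ ℓ₁ = a⁻¹`, THE RELATIVE SIGN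
# `χ_s(ℓ₁) = χ_w(a⁻¹) = (δ², a)_v = −1`, AND THE DOUBLING `Σ_q (F + F ∘ Ad d_a)(w_Δ q̃) = 2 · Σ_q F(w_Δ q̃)`

Cell `hodgecm-mathlib`, crux item hLiu418 = `stmt-HodgeConjecture-24832`; squad K2 ∕ K2Liu; LEAD F0P6-plan (g14), organ lead K2Liu-p06 (g4);
prover K2Liu-p07 (g3).  THEOREMS ONLY (no `def`, no instance, no notation, no named-fact hypothesis, no `sorry`); lane
`--supports stmt-HodgeConjecture-24832 --as helper`.

WHY.  ★ `K2LiuLocalSWRamifiedRelativeSign` reduces the socket binder `hsum` of the ramified similitude witness `f₀ = F + μ·(F ∘ Ad d_a)` to the one-space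
big-cell sum of `F` times `1 + μ·χ_s(ℓ_a)`, with the rank relation `χ_s(ℓ_a) = χ_s(ℓ₁)^n`.  Here the ONE number is computed for Kudla's CM datum
(`L` CM, `E = L`, `F = L⁺`, `c` = complex conjugation, `δ = imagUnit L`, `χv w = χ_w⁻¹` for a weight-one splitting character `χ`): at a NON-SPLIT place
`v` and for a `v`-adic UNIT `a ∈ L⁺` with `(δ², a)_v = −1` (a local non-norm — at a ramified place such units exist, `N(Π)` being a uniformiser),
`χ_s(ℓ₁) = χ_{w₀}⁻¹(a_{w₀}⁻¹)·|a⁻¹|^{s+n∕2} = (δ², a⁻¹)_v = (δ², a)_v = −1` (★ `isEpsilonChar_localComponent_inv` = [HKS96 (1.5)] `χ|_{𝔸_{L⁺}ˣ} = ε_{L∕L⁺}`),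
so `μ = −χ_s(ℓ₁)⁻¹ = 1`, the witness is `f₀ = F + F ∘ Ad(d_a)` and for even `n` (Liu: `n = 2`) **`Σ_q f₀(w_Δ q̃) = 2 · Σ_q F(w_Δ q̃)`** — the
separating input at ramified places (referee AUDIT-AW2 «SIGN (M4)»: «`u = F_Φ + D_{u₀}F_Φ`, `T_u(m) = 2γ₂T_w`»; LEAD ADDENDUM (3)); no Weil-index value enters.
* §1 FLIPS (generic quadratic `E∕F`): an element `w₁` with adapted matrix `[[1 − P, P], [P, 1 − P]]`, `P² = P` (for `P = 1` this is `w_Δ`; for `P = E_{ii}`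
  the middle Weyl element flipping ONE line) has `w₁² = 1` (`flip_mul_self`), `Ad(d_a) w₁ = ℓ₁ w₁` (`localCongr_dA_flip`) with `ℓ₁ ∈ P_Δ`
  (`isSiegelDelta_localCongr_dA_flip_mul`) of adapted matrix `[[1 − P + a⁻¹P, 0], [0, 1 − P + aP]]` (`adapt_matA_localCongr_dA_flip_mul`), and for
  `P = E_{ii}`: **`detDelta_localCongr_dA_flipSingle_mul`** `det_Δ(ℓ₁)_w = a_w⁻¹` — the hypothesis `hdet₁` below and of ★ `localSiegelCharacter_leviOfWeyl_eq_pow`.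
* §2 `localSiegelCharacter_eq_neg_one_of_detDelta` — THE SIGN `χ_s(ℓ₁) = −1` for every `ℓ₁` with `det_Δ(ℓ₁)_w = a_w⁻¹`;
* `sum_weylDelta_witness_cm` — `Σ_q (F + μ·F∘Ad d_a)(w_Δ q̃) = (1 + μ(−1)^n)·Σ_q F(w_Δ q̃)`;  `sum_weylDelta_witness_eq_two_mul` — `μ = 1`, `n` even: `= 2·Σ`.
References: [Kudla1994] §3 Thm. 3.1; [HarrisKudlaSweet1996] §1 (1.5), (1.15); [KudlaSweet1997] §1; [CasselsFrohlichANT1967] Ch. VII Prop. 1.2.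
HONEST LABEL.  Count-neutral helper: `HC_CM` is proved only modulo the 7 printed citations (2 remaining named inputs: hLiu418 = `stmt-HodgeConjecture-24832`,
h413 = `stmt-HodgeConjecture-24833`) until rung 0 closes.
-/

set_option autoImplicit false
set_option linter.dupNamespace false -- the mandated namespace repeats `HodgeConjecture.HodgeConjecture`

noncomputable section

open scoped Matrix
open NumberField IsDedekindDomain Matrix
open Literature.NumberTheory.Automorphic Literature.NumberTheory.Automorphic.UnitaryGroup
open Literature.NumberTheory.GelbartRogawski1991.AdaptedBlocks
open Literature.NumberTheory.GelbartRogawski1991.UnitaryDualPair.LocalSplitting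
open Literature.NumberTheory.K2Lit.LocalSiegelDoubled
open Summit.HodgeConjecture.HodgeConjecture.Cruxes.HLiu418.K2LiuLocalSWSimilitudeAlgebra
open Summit.HodgeConjecture.HodgeConjecture.Cruxes.HLiu418.K2LiuLocalSWSimilitudeSections
open Summit.HodgeConjecture.HodgeConjecture.Cruxes.HLiu418.K2LiuLocalSWRamifiedRelativeSign

namespace Summit.HodgeConjecture.HodgeConjecture.Cruxes.HLiu418.K2LiuLocalSWRamifiedRankOneSign

/-! ## §1 The rank-`r` flip: `Ad(d_a) w₁ = ℓ₁ · w₁` with `ℓ₁ ∈ P_Δ`, `det_Δ ℓ₁ = det(1 − P + a⁻¹P)` (`= a⁻¹` for the flip of ONE line) -/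

section Flip

variable (F : Type) [Field F] [NumberField F] (E : Type) [Field E] [NumberField E] [Algebra F E] [Algebra.IsQuadraticExtension F E]
  (c : E ≃ₐ[F] E) {δ : E} (hcδ : c δ = -δ) (hδ : δ ≠ 0) {d : F} (hd : δ * δ = algebraMap F E d)
  (v : HeightOneSpectrum (𝓞 F)) (n : ℕ) {T₀ : Matrix (Fin n) (Fin n) F} (hT₀ : T₀.IsSymm)
  {JD : Matrix (Fin (n + n)) (Fin (n + n)) E} (hJD : JD = (gramD F n T₀).map (algebraMap F E))
  (a : Fˣ) {D₀ : GL (Fin (n + n)) F}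
  (hD₀ : (D₀ : Matrix (Fin (n + n)) (Fin (n + n)) F) =
    Matrix.reindex (e₂ n) (e₂ n) (cayR F (Fin n) * Matrix.fromBlocks 1 0 0 ((a : F) • (1 : Matrix (Fin n) (Fin n) F)) * cayRinv F (Fin n)))
  {DA : GL (Fin (n + n)) E} (hDA : DA = Matrix.GeneralLinearGroup.map (algebraMap F E) D₀)
  {b : E} (hb : b ≠ 0) (hDAJ : formCongr (c : E →+* E) DA (b • JD) = JD)
  {x : UnitaryGroup.localPi E c (n + n) JD v} {P : Matrix (Fin n) (Fin n) (LocalRing E v)} (hP : P * P = P)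
  (hx : adapt (matA F E c v n x) = Matrix.fromBlocks (1 - P) P P (1 - P))

omit [Algebra.IsQuadraticExtension F E] in
include hP hx in
/-- **a FLIP is an involution**: an element `w₁` with adapted matrix `[[1 − P, P], [P, 1 − P]]`, `P² = P` (the Weyl element flipping the lines in the image of
`P` — for `P = 1` this is `w_Δ`, for `P` a coordinate projector of rank one the middle Weyl element) satisfies `w₁² = 1`. [cite: Kudla1994, §3] -/
theorem flip_mul_self : x * x = 1 := by
  have h1 : (1 - P) * (1 - P) = 1 - P := by rw [sub_mul, one_mul, mul_sub, mul_one, hP, sub_self, sub_zero]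
  have h2 : (1 - P) * P = 0 := by rw [sub_mul, one_mul, hP, sub_self]
  have h3 : P * (1 - P) = 0 := by rw [mul_sub, mul_one, hP, sub_self]
  apply matA_injective F E c v n
  apply eq_of_adapt_eq
  rw [← matA_mul, adapt_mul, hx, matA_one, adapt_one, Matrix.fromBlocks_multiply]
  simp only [h1, h2, h3, hP, add_zero, sub_add_cancel, add_sub_cancel, Matrix.fromBlocks_one]

omit [Algebra.IsQuadraticExtension F E] in
include hD₀ hDA hP hx in
/-- **THE LEVI LETTER OF A FLIP**: `ℓ₁ := Ad(d_a)(w₁) · w₁` has adapted matrix `[[1 − P + a⁻¹P, 0], [0, 1 − P + aP]]`. [cite: Kudla1994, §3] [cite: HarrisKudlaSweet1996, §1 (1.15)] -/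
theorem adapt_matA_localCongr_dA_flip_mul :
    adapt (matA F E c v n (localCongr E c DA hb hDAJ v x * x)) =
      Matrix.fromBlocks (1 - P + (toLocalRing E v (((a⁻¹ : Fˣ) : F) : v.adicCompletion F)) • P) 0 0
        (1 - P + (toLocalRing E v ((a : F) : v.adicCompletion F)) • P) := by
  have hblk := hx
  rw [adapt_eq] at hblk
  obtain ⟨hA, hB, hC, hD⟩ := Matrix.fromBlocks_inj.1 hblk
  have h1 : (1 - P) * (1 - P) = 1 - P := by rw [sub_mul, one_mul, mul_sub, mul_one, hP, sub_self, sub_zero]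
  have h2 : (1 - P) * P = 0 := by rw [sub_mul, one_mul, hP, sub_self]
  have h3 : P * (1 - P) = 0 := by rw [mul_sub, mul_one, hP, sub_self]
  rw [← matA_mul, adapt_mul, adapt_matA_localCongr_dA F E c v n a hD₀ hDA hb hDAJ, hA, hB, hC, hD, hx, Matrix.fromBlocks_multiply,
    Matrix.fromBlocks_inj]
  exact ⟨by rw [Matrix.smul_mul, h1, hP], by rw [Matrix.smul_mul, h2, h3, smul_zero, add_zero], by rw [Matrix.smul_mul, h3, h2, smul_zero, zero_add],
    by rw [Matrix.smul_mul, hP, h1, add_comm]⟩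

include hD₀ hDA hP hx in
/-- `ℓ₁ ∈ P_Δ(F_v)`. [cite: Kudla1994, §3] -/
theorem isSiegelDelta_localCongr_dA_flip_mul :
    IsSiegelDelta F E c hcδ hδ hd v n hT₀ hJD (localCongr E c DA hb hDAJ v x * x) := by
  rw [isSiegelDelta_iff_blkC_eq_zero, blkC_eq_toBlocks₂₁_adapt, adapt_matA_localCongr_dA_flip_mul F E c v n a hD₀ hDA hb hDAJ hP hx,
    Matrix.toBlocks_fromBlocks₂₁]

omit [Algebra.IsQuadraticExtension F E] in
include hP hx in
/-- **`Ad(d_a) w₁ = ℓ₁ · w₁`**. [cite: Kudla1994, §3] -/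
theorem localCongr_dA_flip : localCongr E c DA hb hDAJ v x = (localCongr E c DA hb hDAJ v x * x) * x := by
  rw [mul_assoc, flip_mul_self F E c v n hP hx, mul_one]

omit [Algebra.IsQuadraticExtension F E] in
include hD₀ hDA hP hx in
/-- `det_Δ(ℓ₁)_w = det(1 − P + a⁻¹P)_w`. [cite: Kudla1994, §3] [cite: HarrisKudlaSweet1996, §1 (1.15)] -/
theorem detDelta_localCongr_dA_flip_mul (w : PlacesOver E v) :
    detDelta F E c v n w (localCongr E c DA hb hDAJ v x * x) = (1 - P + (toLocalRing E v (((a⁻¹ : Fˣ) : F) : v.adicCompletion F)) • P).det w := by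
  have h := adapt_matA_localCongr_dA_flip_mul F E c v n a hD₀ hDA hb hDAJ hP hx
  rw [adapt_eq] at h
  obtain ⟨hA, -, hC, -⟩ := Matrix.fromBlocks_inj.1 h
  rw [detDelta_eq, hA, hC, add_zero]

end Flip

section FlipOne

variable (F : Type) [Field F] [NumberField F] (E : Type) [Field E] [NumberField E] [Algebra F E]
  (c : E ≃ₐ[F] E) (v : HeightOneSpectrum (𝓞 F)) (n : ℕ) {JD : Matrix (Fin (n + n)) (Fin (n + n)) E}
  (a : Fˣ) {D₀ : GL (Fin (n + n)) F}
  (hD₀ : (D₀ : Matrix (Fin (n + n)) (Fin (n + n)) F) =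
    Matrix.reindex (e₂ n) (e₂ n) (cayR F (Fin n) * Matrix.fromBlocks 1 0 0 ((a : F) • (1 : Matrix (Fin n) (Fin n) F)) * cayRinv F (Fin n)))
  {DA : GL (Fin (n + n)) E} (hDA : DA = Matrix.GeneralLinearGroup.map (algebraMap F E) D₀)
  {b : E} (hb : b ≠ 0) (hDAJ : formCongr (c : E →+* E) DA (b • JD) = JD)

include hD₀ hDA in
/-- **THE RANK-ONE LETTER `det_Δ(ℓ₁)_w = a_w⁻¹`**: for the flip `w₁` of ONE line (`P = E_{ii}`), `ℓ₁ = Ad(d_a)(w₁)·w₁ = m(diag(…, a⁻¹, …))` has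
`det_Δ(ℓ₁)_w = ι_w(a⁻¹)` — the hypothesis `hdet₁` of `localSiegelCharacter_leviOfWeyl_eq_pow` and of ★ `K2LiuLocalSWRamifiedRelativeSignCM`.
[cite: Kudla1994, §3] [cite: HarrisKudlaSweet1996, §1 (1.15)] -/
theorem detDelta_localCongr_dA_flipSingle_mul (i : Fin n) {x : UnitaryGroup.localPi E c (n + n) JD v}
    (hx : adapt (matA F E c v n x) =
      Matrix.fromBlocks (1 - Matrix.single i i 1) (Matrix.single i i 1) (Matrix.single i i 1) (1 - Matrix.single i i 1))
    (w : PlacesOver E v) :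
    detDelta F E c v n w (localCongr E c DA hb hDAJ v x * x) = toLocalRing E v (((a⁻¹ : Fˣ) : F) : v.adicCompletion F) w := by
  classical
  have hP : Matrix.single i i (1 : LocalRing E v) * Matrix.single i i 1 = Matrix.single i i 1 := by
    rw [Matrix.single_mul_single_same, mul_one]
  have hM : (1 : Matrix (Fin n) (Fin n) (LocalRing E v)) - Matrix.single i i 1 +
      (toLocalRing E v (((a⁻¹ : Fˣ) : F) : v.adicCompletion F)) • Matrix.single i i 1 =
        Matrix.diagonal fun j => if j = i then toLocalRing E v (((a⁻¹ : Fˣ) : F) : v.adicCompletion F) else 1 := by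
    refine Matrix.ext fun j k => ?_
    simp only [Matrix.add_apply, Matrix.sub_apply, Matrix.smul_apply, Matrix.one_apply, Matrix.single_apply, Matrix.diagonal_apply, smul_eq_mul]
    by_cases hjk : j = k
    · subst hjk
      by_cases hji : j = i
      · subst hji; simp
      · simp [hji, Ne.symm hji]
    · have hc : ¬ (i = j ∧ i = k) := fun h => hjk (h.1.symm.trans h.2)
      simp [hjk, hc]
  rw [detDelta_localCongr_dA_flip_mul F E c v n a hD₀ hDA hb hDAJ hP hx w, hM, Matrix.det_diagonal, Finset.prod_ite_eq' Finset.univ i,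
    if_pos (Finset.mem_univ i)]

end FlipOne


/-! ## §2 The CM numbers: `χ_s(ℓ₁) = χ_w(a⁻¹) = (δ², a)_v = −1` for a unit non-norm `a` at a non-split place; the witness sum doubles -/

section CM

open Literature.NumberTheory.QuadraticForms Literature.RepresentationTheory.HarrisKudlaSweet1996 Literature.NumberTheory.GaloisRepresentations
open Literature.NumberTheory.GelbartRogawski1991.UnitaryDualPair

variable (L : Type) [Field L] [NumberField L] [IsCMField L] (v : HeightOneSpectrum (𝓞 (maximalRealSubfield L))) (n : ℕ)
  {T₀ : Matrix (Fin n) (Fin n) (maximalRealSubfield L)} (hT₀ : T₀.IsSymm)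
  {JD : Matrix (Fin (n + n)) (Fin (n + n)) L} (hJD : JD = (gramD (maximalRealSubfield L) n T₀).map (algebraMap (maximalRealSubfield L) L))
  (χ : HeckeCharacter L) (hχ : IsSplittingChar L 1 χ) (s : ℂ)
  (w₀ : PlacesOver L v) (hw₀ : IsCMField.complexConj L • w₀.1 = w₀.1)
  (a : (maximalRealSubfield L)ˣ)
  (ha₁ : ‖toPlace v w₀ ((a : maximalRealSubfield L) : v.adicCompletion (maximalRealSubfield L))‖ = 1)
  (ha : hilbertSymbol (v.adicCompletion (maximalRealSubfield L)) ((imagUnitSq L : maximalRealSubfield L) : v.adicCompletion (maximalRealSubfield L))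
    ((a : maximalRealSubfield L) : v.adicCompletion (maximalRealSubfield L)) = -1)

include hχ hw₀ ha₁ ha in
/-- **THE SIGN.**  `L` CM, `χ` a weight-one splitting character (`χ|_{𝔸_{L⁺}ˣ} = ε_{L∕L⁺}`, so `χ_w⁻¹|_{L⁺_vˣ} = (δ², ·)_v`, ★ `isEpsilonChar_localComponent_inv`),
`v` NON-SPLIT (`w₀ ∣ v` fixed by conjugation), `a ∈ L⁺` a `v`-adic UNIT with `(δ², a)_v = −1` (a local non-norm from `L_{w₀}`; at a ramified place such units
exist).  Then for every `ℓ₁ ∈ U(J_D)(L⁺_v)` with `det_Δ(ℓ₁)_w = a_w⁻¹` — the Levi letter of a rank-one Weyl word under `Ad(d_a)` — and every `s`: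
`χ_v(det_Δ ℓ₁)|det_Δ ℓ₁|_v^{s+n∕2} = −1` for the family `χv w = χ_w⁻¹` of Kudla's CM datum. [cite: HarrisKudlaSweet1996, §1 (1.5), (1.15)] [cite: Kudla1994, §3, Thm. 3.1] -/
theorem localSiegelCharacter_eq_neg_one_of_detDelta {ℓ₁ : UnitaryGroup.localPi L (IsCMField.complexConj L) (n + n) JD v}
    (hdet₁ : ∀ w, detDelta (maximalRealSubfield L) L (IsCMField.complexConj L) v n w ℓ₁ =
      toLocalRing L v (((a⁻¹ : (maximalRealSubfield L)ˣ) : maximalRealSubfield L) : v.adicCompletion (maximalRealSubfield L)) w) :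
    localSiegelCharacter (maximalRealSubfield L) L (IsCMField.complexConj L) v n (fun w => (χ.localComponent w.1)⁻¹) s ℓ₁ = -1 := by
  classical
  haveI : Subsingleton (PlacesOver L v) :=
    PlacesOver.subsingleton_of_smul_eq (IsCMField.complexConj L) (IsCMField.complexConj_ne_one L) w₀ hw₀
  set Kv := v.adicCompletion (maximalRealSubfield L)
  have ha0 : ((a : maximalRealSubfield L) : Kv) ≠ 0 :=
    (map_ne_zero (algebraMap (maximalRealSubfield L) Kv)).2 a.ne_zero
  -- the unit `a` read in `Kvˣ`, and `a⁻¹`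
  set aK : Kvˣ := Units.mk0 ((a : maximalRealSubfield L) : Kv) ha0 with haK
  have hinv : (((a⁻¹ : (maximalRealSubfield L)ˣ) : maximalRealSubfield L) : Kv) = ((aK⁻¹ : Kvˣ) : Kv) := by
    rw [Units.val_inv_eq_inv_val aK, haK, Units.val_mk0, Units.val_inv_eq_inv_val]
    exact map_inv₀ (algebraMap (maximalRealSubfield L) Kv) _
  have hu : IsUnit (detDelta (maximalRealSubfield L) L (IsCMField.complexConj L) v n w₀ ℓ₁) := by
    rw [hdet₁ w₀]; exact (isUnit_toLocalRing_coe (maximalRealSubfield L) L v a⁻¹).map (Pi.evalRingHom _ w₀)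
  have hunit : hu.unit = Units.map (toPlace v w₀ : Kv →+* w₀.1.adicCompletion L).toMonoidHom aK⁻¹ := by
    ext
    rw [IsUnit.unit_spec, hdet₁ w₀, toLocalRing_apply, hinv, Units.coe_map, RingHom.toMonoidHom_eq_coe, MonoidHom.coe_coe]
  -- the character value
  have hε := isEpsilonChar_localComponent_inv (L := L) (v := v) χ hχ w₀ hw₀ aK⁻¹
  have hval : (((χ.localComponent w₀.1)⁻¹ hu.unit : ℂˣ) : ℂ) = -1 := by
    rw [hunit]
    refine hε.trans ?_
    have hsq : ((aK⁻¹ : Kvˣ) : Kv) = (aK : Kv) * ((aK : Kv)⁻¹) ^ 2 := by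
      rw [Units.val_inv_eq_inv_val, sq, ← mul_assoc, mul_inv_cancel₀ (by rw [haK, Units.val_mk0]; exact ha0), one_mul]
    rw [hsq, hilbertSymbol_mul_sq_right _ _ (inv_ne_zero (by rw [haK, Units.val_mk0]; exact ha0)), haK, Units.val_mk0, ha]
    norm_num
  -- the modulus
  have hnorm : ‖detDelta (maximalRealSubfield L) L (IsCMField.complexConj L) v n w₀ ℓ₁‖ = 1 := by
    rw [hdet₁ w₀, toLocalRing_apply, hinv, Units.val_inv_eq_inv_val, map_inv₀, norm_inv, haK, Units.val_mk0, ha₁, inv_one]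
  unfold localSiegelCharacter chiDet absDetDelta
  rw [Fintype.prod_subsingleton _ w₀, Fintype.prod_subsingleton _ w₀, dif_pos hu, hval, hnorm, Complex.ofReal_one, Complex.one_cpow, mul_one]

variable {D₀ : GL (Fin (n + n)) (maximalRealSubfield L)}
  (hD₀ : (D₀ : Matrix (Fin (n + n)) (Fin (n + n)) (maximalRealSubfield L)) =
    Matrix.reindex (e₂ n) (e₂ n) (cayR (maximalRealSubfield L) (Fin n) *
      Matrix.fromBlocks 1 0 0 ((a : maximalRealSubfield L) • (1 : Matrix (Fin n) (Fin n) (maximalRealSubfield L))) * cayRinv (maximalRealSubfield L) (Fin n)))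
  {DA : GL (Fin (n + n)) L} (hDA : DA = Matrix.GeneralLinearGroup.map (algebraMap (maximalRealSubfield L) L) D₀)
  {b : L} (hb : b ≠ 0) (hDAJ : formCongr ((IsCMField.complexConj L : L ≃ₐ[maximalRealSubfield L] L) : L →+* L) DA (b • JD) = JD)

include hχ hD₀ hDA hw₀ ha₁ ha in
/-- **THE RAMIFIED WITNESS SUM, CM DATUM**: for a Siegel section `F ∈ I_v(s, χ_v)` (`χv w = χ_w⁻¹`), coordinate subgroups `N_{Λ₀} ≤ N_Λ` with `a⁻¹`-stable boxes,
`F` right-`N_{Λ₀}`-invariant, and ANY witness to the rank-one letter (`ℓ₁` with `det_Δ(ℓ₁)_w = a_w⁻¹`):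
`Σ_{q ∈ N_Λ⧸N_{Λ₀}} (F + μ·(F ∘ Ad d_a))(w_Δ q̃) = (1 + μ·(−1)^n) · Σ_q F(w_Δ q̃)`. [cite: Kudla1994, §3] [cite: HarrisKudlaSweet1996, §1 (1.15)] [cite: KudlaSweet1997, §1] -/
theorem sum_weylDelta_witness_cm {F₀ : UnitaryGroup.localPi L (IsCMField.complexConj L) (n + n) JD v → ℂ}
    (hF : IsLocalSiegelSection (maximalRealSubfield L) L (IsCMField.complexConj L) (complexConj_imagUnit L) (imagUnit_ne_zero L) (imagUnit_mul_self L)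
      v n hT₀ hJD (fun w => (χ.localComponent w.1)⁻¹) s F₀) (μ : ℂ)
    {N₀ N₁ : Subgroup (UnitaryGroup.localPi L (IsCMField.complexConj L) (n + n) JD v)} {Λ₀ Λ : Set (Matrix (Fin n) (Fin n) (LocalRing L v))}
    (hN₀ : ∀ u, u ∈ N₀ ↔ u ∈ unipDeltaLocal (maximalRealSubfield L) L (IsCMField.complexConj L) v n (JD := JD) ∧
      blkB (matA (maximalRealSubfield L) L (IsCMField.complexConj L) v n u) ∈ Λ₀)
    (hN₁ : ∀ u, u ∈ N₁ ↔ u ∈ unipDeltaLocal (maximalRealSubfield L) L (IsCMField.complexConj L) v n (JD := JD) ∧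
      blkB (matA (maximalRealSubfield L) L (IsCMField.complexConj L) v n u) ∈ Λ)
    (hΛ₀ : ∀ B, (toLocalRing L v (((a⁻¹ : (maximalRealSubfield L)ˣ) : maximalRealSubfield L) : v.adicCompletion (maximalRealSubfield L))) • B ∈ Λ₀ ↔ B ∈ Λ₀)
    (hΛ : ∀ B, (toLocalRing L v (((a⁻¹ : (maximalRealSubfield L)ˣ) : maximalRealSubfield L) : v.adicCompletion (maximalRealSubfield L))) • B ∈ Λ ↔ B ∈ Λ)
    [Fintype (N₁ ⧸ N₀.subgroupOf N₁)] (hFinv : ∀ h, ∀ u ∈ N₀, F₀ (h * u) = F₀ h)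
    {ℓ₁ : UnitaryGroup.localPi L (IsCMField.complexConj L) (n + n) JD v}
    (hdet₁ : ∀ w, detDelta (maximalRealSubfield L) L (IsCMField.complexConj L) v n w ℓ₁ =
      toLocalRing L v (((a⁻¹ : (maximalRealSubfield L)ˣ) : maximalRealSubfield L) : v.adicCompletion (maximalRealSubfield L)) w) :
    ∑ q : N₁ ⧸ N₀.subgroupOf N₁, (fun x => F₀ x + μ * F₀ (localCongr L (IsCMField.complexConj L) DA hb hDAJ v x))
        (weylDelta (maximalRealSubfield L) L (IsCMField.complexConj L) v n hJD * (q.out : UnitaryGroup.localPi L (IsCMField.complexConj L) (n + n) JD v)) =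
      (1 + μ * (-1) ^ n) *
        ∑ q : N₁ ⧸ N₀.subgroupOf N₁, F₀ (weylDelta (maximalRealSubfield L) L (IsCMField.complexConj L) v n hJD *
          (q.out : UnitaryGroup.localPi L (IsCMField.complexConj L) (n + n) JD v)) := by
  rw [sum_weylDelta_witness_localCongr_dA (maximalRealSubfield L) L (IsCMField.complexConj L) (complexConj_imagUnit L) (imagUnit_ne_zero L)
      (imagUnit_mul_self L) v n hT₀ hJD _ s a hD₀ hDA hb hDAJ hF μ hN₀ hN₁ hΛ₀ hΛ hFinv,
    localSiegelCharacter_leviOfWeyl_eq_pow (maximalRealSubfield L) L (IsCMField.complexConj L) v n hJD _ s a hD₀ hDA hb hDAJ hdet₁,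
    localSiegelCharacter_eq_neg_one_of_detDelta L v n χ hχ s w₀ hw₀ a ha₁ ha hdet₁]

include hχ hD₀ hDA hw₀ ha₁ ha in
/-- **THE RAMIFIED WITNESS `f₀ = F + F ∘ Ad(d_a)` (`μ = 1`, `n` even — Liu: `n = 2`): `Σ_{q ∈ N_Λ⧸N_{Λ₀}} f₀(w_Δ q̃) = 2 · Σ_q F(w_Δ q̃)`** — so `hsum(f₀) ≠ 0`
iff the ONE-space big-cell sum of `F` is non-zero.  This is the separating input at a ramified place: the relative sign `χ_w(a⁻¹) = ε_w(a) = −1` of the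
rank-one against the rank-two Weyl word (referee AUDIT-AW2 «SIGN (M4)»; LEAD RULING M-158a ADDENDUM (3)); no Weil-index value enters.
[cite: Kudla1994, §3, Thm. 3.1] [cite: HarrisKudlaSweet1996, §1 (1.15)] [cite: KudlaSweet1997, §1] -/
theorem sum_weylDelta_witness_eq_two_mul (hn : Even n) {F₀ : UnitaryGroup.localPi L (IsCMField.complexConj L) (n + n) JD v → ℂ}
    (hF : IsLocalSiegelSection (maximalRealSubfield L) L (IsCMField.complexConj L) (complexConj_imagUnit L) (imagUnit_ne_zero L) (imagUnit_mul_self L)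
      v n hT₀ hJD (fun w => (χ.localComponent w.1)⁻¹) s F₀)
    {N₀ N₁ : Subgroup (UnitaryGroup.localPi L (IsCMField.complexConj L) (n + n) JD v)} {Λ₀ Λ : Set (Matrix (Fin n) (Fin n) (LocalRing L v))}
    (hN₀ : ∀ u, u ∈ N₀ ↔ u ∈ unipDeltaLocal (maximalRealSubfield L) L (IsCMField.complexConj L) v n (JD := JD) ∧
      blkB (matA (maximalRealSubfield L) L (IsCMField.complexConj L) v n u) ∈ Λ₀)
    (hN₁ : ∀ u, u ∈ N₁ ↔ u ∈ unipDeltaLocal (maximalRealSubfield L) L (IsCMField.complexConj L) v n (JD := JD) ∧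
      blkB (matA (maximalRealSubfield L) L (IsCMField.complexConj L) v n u) ∈ Λ)
    (hΛ₀ : ∀ B, (toLocalRing L v (((a⁻¹ : (maximalRealSubfield L)ˣ) : maximalRealSubfield L) : v.adicCompletion (maximalRealSubfield L))) • B ∈ Λ₀ ↔ B ∈ Λ₀)
    (hΛ : ∀ B, (toLocalRing L v (((a⁻¹ : (maximalRealSubfield L)ˣ) : maximalRealSubfield L) : v.adicCompletion (maximalRealSubfield L))) • B ∈ Λ ↔ B ∈ Λ)
    [Fintype (N₁ ⧸ N₀.subgroupOf N₁)] (hFinv : ∀ h, ∀ u ∈ N₀, F₀ (h * u) = F₀ h)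
    {ℓ₁ : UnitaryGroup.localPi L (IsCMField.complexConj L) (n + n) JD v}
    (hdet₁ : ∀ w, detDelta (maximalRealSubfield L) L (IsCMField.complexConj L) v n w ℓ₁ =
      toLocalRing L v (((a⁻¹ : (maximalRealSubfield L)ˣ) : maximalRealSubfield L) : v.adicCompletion (maximalRealSubfield L)) w) :
    ∑ q : N₁ ⧸ N₀.subgroupOf N₁, (fun x => F₀ x + F₀ (localCongr L (IsCMField.complexConj L) DA hb hDAJ v x))
        (weylDelta (maximalRealSubfield L) L (IsCMField.complexConj L) v n hJD * (q.out : UnitaryGroup.localPi L (IsCMField.complexConj L) (n + n) JD v)) =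
      2 * ∑ q : N₁ ⧸ N₀.subgroupOf N₁, F₀ (weylDelta (maximalRealSubfield L) L (IsCMField.complexConj L) v n hJD *
          (q.out : UnitaryGroup.localPi L (IsCMField.complexConj L) (n + n) JD v)) := by
  have h := sum_weylDelta_witness_cm L v n hT₀ hJD χ hχ s w₀ hw₀ a ha₁ ha hD₀ hDA hb hDAJ hF 1 hN₀ hN₁ hΛ₀ hΛ hFinv hdet₁
  simp only [one_mul, hn.neg_one_pow] at h
  rw [h]
  norm_num

end CM

end Summit.HodgeConjecture.HodgeConjecture.Cruxes.HLiu418.K2LiuLocalSWRamifiedRankOneSign
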